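import Summits.QuantumFields.BalabanUV.Beta.FP.PerfectPolarizationGerm

/-!
# `BalabanUV.Beta.FP.PerfectPolarizationDecay` — road «FP» for binder row D1, leaf (H2), row **H2-ASM-5** (owner END), module D:
# (K6) FOR THE EXPLICIT KERNEL `PiBF` — SEXTIC DECAY ON ALL OF `ℤ⁴`: `∃ C ≥ 0, ∀ μ ν t, |PiBF wg wgh V W v w μ ν t| ≤ C ∕ (‖t‖∞+1)⁶`
# over admissible vertex data with BF germs (no colour equation needed) — the `hK` letter of the γ-END (`HorizontalRemainderPerfect` ∕ `RemainderLedger`)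
# and the input of the first-moment Ward passage to (K0) (E-FP-8-3, leaf-01-g10's `WardZerothMomentSextic`)

HONEST DEPENDENCY (page 1, mandatory): continuum YM on T⁴ ⇐ BetaPertH ∧ nine spine estimates (0/9 proved); BetaPertH ⇐ (D1) ∧ (D4) ∧
CAP+tail; G-an2-4 gates asym, D1 and NE2/3/4.  HONEST FRAMING (cell contract, verbatim): «discharging `BetaPertH` makes Bałaban's UV
stability UNCONDITIONAL — a real constructive-QFT result; it is NOT the continuum limit and NOT the Clay problem.»  THIS MODULE composes module C's far letter
`PerfectPolarizationGerm.abs_PiBF_sub_germFace_le_far` (`4 ≤ ‖z‖∞`) with FILE 1's `PolarizationGermBubble.germFace_eq_transverse` and the closed form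
`TransverseStructure.transverse_eq` (`|T_{μν}(x)| ≤ 36∕‖x‖∞⁶`), and absorbs the finitely many points `‖t‖∞ ≤ 3` into a finite sum.  Hypotheses = module C's vertex
letters and germ identities (displayed); the weights are free.  No `def`, no `def … : Prop`, nothing cited, 0 sorry.  WHAT IT IS: the sextic decay of an EXPLICIT kernel;
WHAT IT IS NOT: not (Kcov)∕(K0), not hbook; 0∕4 row-D1 binders; NOT D1, NOT BetaPertH, NOT continuum, NOT Clay.

ABSOLUTE RULE (cell charter, verbatim): «No internally-minted statement may enter as a cited fact. Every hypothesis is either kernel-proved in this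
package or a verbatim quotation of a PUBLISHED theorem with page reference. The manuscript(s) under audit are NOT citable for their own disputed
steps — they are the thing under adjudication; programme-internal (2001/route/tribunal) claims are never citable.»

CONTENT.  §1 [folklore] `abs_transverse_toReal_le` (`z ≠ 0`: `|transverse μ ν (toReal z)| ≤ 36∕‖z‖∞⁶`).  §2 [our object] `abs_PiBF_le_far` (`4 ≤ ‖z‖∞`:
`|PiBF μ ν z| ≤ (A_far + 36·|coef|)∕‖z‖∞⁶`, `coef = (10·wg·(c₄cQ)² + wgh·c₄²∕2)∕3`).  §3 [our object] **`sextic_PiBF`** — (K6) on all of `ℤ⁴` (`∃ C ≥ 0`, uniform in `μ ν`).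
Provenance: road FP OWNER b2b-balaban-beta-d1-p3 gen 8 (prover-b2b-balaban-beta-d1-p3-g8-0), 2026-08-21, row H2-ASM-5 module D; «not in print; our bookkeeping».
-/

noncomputable section

namespace Summit.QuantumFields.BalabanUV.Beta.FP.PerfectPolarizationDecay

open Finset fwdDiff
open scoped BigOperators
open Literature.Probability.LatticeModels (latticeGreen annulus box)
open Literature.MathematicalPhysics.QuantumFieldTheory.Balaban1983to89
open Literature.MathematicalPhysics.QuantumFieldTheory.Balaban1983to89.Beta
open Literature.MathematicalPhysics.QuantumFieldTheory.Balaban1983to89.Beta.TransverseStructure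
open Literature.MathematicalPhysics.QuantumFieldTheory.Balaban1983to89.Beta.BubbleTransfer
open Literature.MathematicalPhysics.QuantumFieldTheory.Balaban1983to89.Beta.TwoPowerLegs (TwoPower free free_g)
open B12Sec2to5 (l1 l1_nonneg)
open ExpKernelCalculus (Site MKer BiLoc bubble tadpole hessKer shiftK Zl)
open OneStepResolventKernel (Fib LocStencil)
open DyadicShell (Pt supNorm toReal toReal_apply supNorm_pos supNorm_eq_zero_iff mem_box_iff mem_annulus_iff supNorm_eq_of_mem_sphere)
open LeadingCoefficient (leadingIntegrand kappaBal)
open Summit.QuantumFields.BalabanUV.Beta.FP.MarginalUniqueness (Idx CubicGerm)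
open Summit.QuantumFields.BalabanUV.Beta.FP.WilsonCubicGerm (cubicGermOf)
open Summit.QuantumFields.BalabanUV.Beta.FP.GhostCubicGerm (cubicGermOfSc)
open Summit.QuantumFields.BalabanUV.Beta.FP.BubbleGermValue (bfGerm ghostGerm)
open Summit.QuantumFields.BalabanUV.Beta.FP.PolarizationGermBubble (leadGerm leadGermSc germFace_eq germFace_eq_transverse)
open Summit.QuantumFields.BalabanUV.Beta.FP.PolarizationGermLegs (Cbub)
open Summit.QuantumFields.BalabanUV.Beta.FP.PolarizationGerm (abs_half_tadpole_le)
open Summit.QuantumFields.BalabanUV.Beta.FP.PolarizationGermPker (abs_bubble_Pker_sub_leadGerm_le)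
open Summit.QuantumFields.BalabanUV.Beta.FP.PolarizationGermGhost (abs_bubble_G0ker_sub_leadGermSc_le)
open Summit.QuantumFields.BalabanUV.Beta.FP.PerfectPolarization (Pker G0ker G0ker_apply PiBF PiBF_def Pker_translate G0ker_translate)
open Summit.QuantumFields.BalabanUV.Beta.FP.PerfectPropagatorLegData (A0P A1P A2P A3P D0P D1P D2P)
open Summit.QuantumFields.BalabanUV.Beta.FP.PerfectPropagatorLegDataFree (B3free)
open Summit.QuantumFields.BalabanUV.Beta.FP.ExpLocalisedBubblePker (abs_Pker_le)
open Summit.QuantumFields.BalabanUV.Beta.FP.ExpLocalisedBubbleOrder2Point (Θ Θ_nonneg)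
open Summit.QuantumFields.BalabanUV.Beta.FP.PolarizationColour (germPol_hval_of_total)
open Summit.QuantumFields.BalabanUV.Beta.FP.HorizontalGerm (hgerm_stepBal_of_leadingGerm)
open Summit.QuantumFields.BalabanUV.Beta.FP.FarRegionSmearGraded (pow_mul_exp_neg_le)
open Summit.QuantumFields.BalabanUV.Beta.FP.LegPairingBounds (supNorm_le_l1)

open Summit.QuantumFields.BalabanUV.Beta.FP.PerfectPolarizationGerm (abs_PiBF_sub_germFace_le_far)
open TransverseStructure (transverse transverse_eq r2 r2_pos)
open Literature.MathematicalPhysics.QuantumFieldTheory.Balaban1983to89.Beta.TwoPowerLegs (norm_sq_le_r2)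

/-! ## §1 The transverse structure on lattice points -/

/-- [folklore] `|T_{μν}(X)| ≤ 36∕‖z‖∞⁶` at `X = toReal z`, `z ≠ 0` (`T = 24X_μX_ν∕r2⁴ − 12δ_{μν}∕r2³`, `r2 X ≥ ‖X‖∞² = ‖z‖∞²`, `|X_μX_ν| ≤ ‖z‖∞²`). -/
theorem abs_transverse_toReal_le (μ ν : Fin 4) {z : Pt} (hz : z ≠ 0) :
    |transverse μ ν (toReal z)| ≤ 36 / (supNorm z : ℝ) ^ 6 := by
  have hx0 : toReal z ≠ 0 := fun h => hz (DyadicShell.toReal_eq_zero_iff.mp h)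
  have hs : (0 : ℝ) < supNorm z := by exact_mod_cast supNorm_pos hz
  set s : ℝ := (supNorm z : ℝ) with hsdef
  have hr : s ^ 2 ≤ r2 (toReal z) := by
    have h := norm_sq_le_r2 (toReal z)
    rwa [DyadicShell.norm_toReal] at h
  have hrpos : 0 < r2 (toReal z) := r2_pos hx0
  have hm : |toReal z μ * toReal z ν| ≤ s ^ 2 := abs_moment_le μ ν z
  have h3 : s ^ 6 ≤ r2 (toReal z) ^ 3 := by
    calc s ^ 6 = (s ^ 2) ^ 3 := by ring
      _ ≤ r2 (toReal z) ^ 3 := pow_le_pow_left₀ (by positivity) hr 3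
  have h4 : s ^ 8 ≤ r2 (toReal z) ^ 4 := by
    calc s ^ 8 = (s ^ 2) ^ 4 := by ring
      _ ≤ r2 (toReal z) ^ 4 := pow_le_pow_left₀ (by positivity) hr 4
  have hA : |24 * toReal z μ * toReal z ν / r2 (toReal z) ^ 4| ≤ 24 / s ^ 6 := by
    rw [abs_div, abs_of_pos (pow_pos hrpos 4), show 24 * toReal z μ * toReal z ν = 24 * (toReal z μ * toReal z ν) by ring, abs_mul,
      abs_of_pos (by norm_num : (0 : ℝ) < 24)]
    rw [div_le_div_iff₀ (pow_pos hrpos 4) (pow_pos hs 6)]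
    calc 24 * |toReal z μ * toReal z ν| * s ^ 6 ≤ 24 * s ^ 2 * s ^ 6 := by
          have := mul_le_mul_of_nonneg_left hm (by norm_num : (0 : ℝ) ≤ 24); nlinarith [pow_pos hs 6]
      _ = 24 * s ^ 8 := by ring
      _ ≤ 24 * r2 (toReal z) ^ 4 := by nlinarith
  have hB : |(if μ = ν then 12 / r2 (toReal z) ^ 3 else 0)| ≤ 12 / s ^ 6 := by
    split_ifs
    · rw [abs_of_pos (by positivity)]
      exact div_le_div_of_nonneg_left (by norm_num) (pow_pos hs 6) h3
    · rw [abs_zero]; positivity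
  rw [transverse_eq]
  refine (abs_sub _ _).trans ((add_le_add hA hB).trans (le_of_eq ?_))
  ring

/-! ## §2 The far shells -/

section Far

variable {V : Fin 4 → Site 4 → MKer 4 (Fib 3)} {W : Fin 4 → Site 4 → Fin 4 → Site 4 → MKer 4 (Fib 3)}
  {v : Fin 4 → Site 4 → MKer 4 Unit} {w : Fin 4 → Site 4 → Fin 4 → Site 4 → MKer 4 Unit}
  {Cs δ Cw Cw' cQ wg wgh : ℝ}

/-- **(K6) ON THE FAR SHELLS** [our object] (`4 ≤ ‖z‖∞`): `|PiBF μ ν z| ≤ (A_far + 36·|coef|)∕‖z‖∞⁶` with module C's `A_far` and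
`coef = (10·wg·(c₄cQ)² + wgh·c₄²∕2)∕3` (FILE 1's `germFace_eq_transverse`). -/
theorem abs_PiBF_le_far (hδ : 0 < δ)
    (hV : LocStencil V Cs δ) (hcovV : ∀ (lam : Fin 4) (u : Site 4), V lam u = shiftK (-u) (V lam 0))
    (h0V : ∀ (lam α β : Fin 4), ∑' p : Pt × Pt, V lam 0 p.1 p.2 (Sum.inl α) (Sum.inl β) = 0)
    (hgermV : cubicGermOf V = cQ • bfGerm)
    (hW : ∀ (μ ν : Fin 4) (z : Pt), BiLoc (W μ 0 ν z) 0 z (Cw * Real.exp (-δ * l1 z)) δ)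
    (hv : ∀ (lam : Fin 4) (u : Site 4), BiLoc (v lam u) u u Cs δ) (hcovv : ∀ (lam : Fin 4) (u : Site 4), v lam u = shiftK (-u) (v lam 0))
    (h0v : ∀ lam : Fin 4, ∑' p : Pt × Pt, v lam 0 p.1 p.2 () () = 0)
    (hgermv : cubicGermOfSc v = ghostGerm)
    (hw : ∀ (μ ν : Fin 4) (z : Pt), BiLoc (w μ 0 ν z) 0 z (Cw' * Real.exp (-δ * l1 z)) δ)
    (μ ν : Fin 4) {z : Pt} (hz : 4 ≤ supNorm z) :
    |PiBF wg wgh V W v w μ ν z|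
      ≤ ((|wg| * ((1 / 2 : ℝ) * ((Fintype.card (Fib 3) : ℝ) ^ 2 * (Cw * Θ δ 0 * A0P)) * (5040 / δ ^ 7)
            + (1 / 2 : ℝ) * Cbub 4 Cs δ A0P A1P A2P A3P D0P D1P D2P)
          + |wgh| * ((1 / 2 : ℝ) * ((Fintype.card Unit : ℝ) ^ 2 * (Cw' * Θ δ 0 * free.U)) * (5040 / δ ^ 7)
            + (1 / 2 : ℝ) * Cbub 1 Cs δ (4 * (free.U + c4 + free.B)) (8 * (2 * free.U + 2 * c4 + free.Bgrad))
                (2 ^ 4 * (64 * B3free + 89098 * c4) + ((4 : ℕ) + 1 : ℝ) ^ 4 * (4 * free.U))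
                (2 ^ 5 * (128 * B3free + 701568 * c4) + ((6 : ℕ) + 1 : ℝ) ^ 5 * (8 * free.U))
                free.B (B3free + 112 * c4) (64 * B3free + 89088 * c4)))
          + 36 * |(10 * wg * (c4 * cQ) ^ 2 + wgh * c4 ^ 2 / 2) / 3|) / (supNorm z : ℝ) ^ 6 := by
  have hz0 : z ≠ 0 := by
    intro h; rw [h] at hz; rw [supNorm_eq_zero_iff.mpr rfl] at hz; omega
  have hx0 : toReal z ≠ 0 := fun h => hz0 (DyadicShell.toReal_eq_zero_iff.mp h)
  have hs : (0 : ℝ) < supNorm z := by exact_mod_cast supNorm_pos hz0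
  have hs1 : (1 : ℝ) ≤ supNorm z := by exact_mod_cast supNorm_pos hz0
  set s : ℝ := (supNorm z : ℝ) with hsdef
  set A : ℝ := (|wg| * ((1 / 2 : ℝ) * ((Fintype.card (Fib 3) : ℝ) ^ 2 * (Cw * Θ δ 0 * A0P)) * (5040 / δ ^ 7)
            + (1 / 2 : ℝ) * Cbub 4 Cs δ A0P A1P A2P A3P D0P D1P D2P)
          + |wgh| * ((1 / 2 : ℝ) * ((Fintype.card Unit : ℝ) ^ 2 * (Cw' * Θ δ 0 * free.U)) * (5040 / δ ^ 7)
            + (1 / 2 : ℝ) * Cbub 1 Cs δ (4 * (free.U + c4 + free.B)) (8 * (2 * free.U + 2 * c4 + free.Bgrad))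
                (2 ^ 4 * (64 * B3free + 89098 * c4) + ((4 : ℕ) + 1 : ℝ) ^ 4 * (4 * free.U))
                (2 ^ 5 * (128 * B3free + 701568 * c4) + ((6 : ℕ) + 1 : ℝ) ^ 5 * (8 * free.U))
                free.B (B3free + 112 * c4) (64 * B3free + 89088 * c4))) with hA
  have hfar := abs_PiBF_sub_germFace_le_far (wg := wg) (wgh := wgh) (cQ := cQ) hδ hV hcovV h0V hgermV hW hv hcovv h0v hgermv hw μ ν hz
  rw [← hA, germFace_eq_transverse wg wgh c4 c4 cQ μ ν hx0] at hfar
  have hA0 : 0 ≤ A := by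
    have h := (abs_nonneg _).trans hfar
    exact (div_nonneg_iff.mp h).elim (fun h => h.1) (fun h => absurd h.2 (not_le.mpr (pow_pos hs 7)))
  have hT := abs_transverse_toReal_le μ ν hz0
  have h1 : |PiBF wg wgh V W v w μ ν z| ≤ A / s ^ 7 + |(10 * wg * (c4 * cQ) ^ 2 + wgh * c4 ^ 2 / 2) / 3| * (36 / s ^ 6) := by
    have e : PiBF wg wgh V W v w μ ν z = (PiBF wg wgh V W v w μ ν z - (10 * wg * (c4 * cQ) ^ 2 + wgh * c4 ^ 2 / 2) / 3 * transverse μ ν (toReal z))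
        + (10 * wg * (c4 * cQ) ^ 2 + wgh * c4 ^ 2 / 2) / 3 * transverse μ ν (toReal z) := by ring
    rw [e]
    refine (abs_add_le _ _).trans (add_le_add hfar ?_)
    rw [abs_mul]
    exact mul_le_mul_of_nonneg_left hT (abs_nonneg _)
  have h2 : A / s ^ 7 ≤ A / s ^ 6 := div_le_div_of_nonneg_left hA0 (pow_pos hs 6) (pow_le_pow_right₀ hs1 (by norm_num))
  refine (h1.trans (add_le_add h2 le_rfl)).trans (le_of_eq ?_)
  field_simp

end Far

/-! ## §3 (K6) on all of `ℤ⁴` -/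

section Sextic

variable {V : Fin 4 → Site 4 → MKer 4 (Fib 3)} {W : Fin 4 → Site 4 → Fin 4 → Site 4 → MKer 4 (Fib 3)}
  {v : Fin 4 → Site 4 → MKer 4 Unit} {w : Fin 4 → Site 4 → Fin 4 → Site 4 → MKer 4 Unit}
  {Cs δ Cw Cw' cQ wg wgh : ℝ}

/-- **(K6) FOR THE EXPLICIT KERNEL `PiBF`** [our object] (row H2-ASM-5, module D): under module C's vertex letters and germ identities (weights free),
`∃ C ≥ 0, ∀ μ ν t, |PiBF wg wgh V W v w μ ν t| ≤ C ∕ (‖t‖∞+1)⁶` — the far shells by `abs_PiBF_le_far` (`‖t‖⁶ ≥ (‖t‖+1)⁶∕64`), the finitely many points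
`‖t‖∞ ≤ 3` (including `t = 0`) by their finite sum over all sixteen index pairs (`(‖t‖+1)⁶ ≤ 4096`). -/
theorem sextic_PiBF (hδ : 0 < δ)
    (hV : LocStencil V Cs δ) (hcovV : ∀ (lam : Fin 4) (u : Site 4), V lam u = shiftK (-u) (V lam 0))
    (h0V : ∀ (lam α β : Fin 4), ∑' p : Pt × Pt, V lam 0 p.1 p.2 (Sum.inl α) (Sum.inl β) = 0)
    (hgermV : cubicGermOf V = cQ • bfGerm)
    (hW : ∀ (μ ν : Fin 4) (z : Pt), BiLoc (W μ 0 ν z) 0 z (Cw * Real.exp (-δ * l1 z)) δ)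
    (hv : ∀ (lam : Fin 4) (u : Site 4), BiLoc (v lam u) u u Cs δ) (hcovv : ∀ (lam : Fin 4) (u : Site 4), v lam u = shiftK (-u) (v lam 0))
    (h0v : ∀ lam : Fin 4, ∑' p : Pt × Pt, v lam 0 p.1 p.2 () () = 0)
    (hgermv : cubicGermOfSc v = ghostGerm)
    (hw : ∀ (μ ν : Fin 4) (z : Pt), BiLoc (w μ 0 ν z) 0 z (Cw' * Real.exp (-δ * l1 z)) δ)
    :
    ∃ C : ℝ, 0 ≤ C ∧ ∀ (μ ν : Fin 4) (t : Pt), |PiBF wg wgh V W v w μ ν t| ≤ C / ((supNorm t : ℝ) + 1) ^ 6 := by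
  classical
  set A6 : ℝ := (|wg| * ((1 / 2 : ℝ) * ((Fintype.card (Fib 3) : ℝ) ^ 2 * (Cw * Θ δ 0 * A0P)) * (5040 / δ ^ 7)
            + (1 / 2 : ℝ) * Cbub 4 Cs δ A0P A1P A2P A3P D0P D1P D2P)
          + |wgh| * ((1 / 2 : ℝ) * ((Fintype.card Unit : ℝ) ^ 2 * (Cw' * Θ δ 0 * free.U)) * (5040 / δ ^ 7)
            + (1 / 2 : ℝ) * Cbub 1 Cs δ (4 * (free.U + c4 + free.B)) (8 * (2 * free.U + 2 * c4 + free.Bgrad))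
                (2 ^ 4 * (64 * B3free + 89098 * c4) + ((4 : ℕ) + 1 : ℝ) ^ 4 * (4 * free.U))
                (2 ^ 5 * (128 * B3free + 701568 * c4) + ((6 : ℕ) + 1 : ℝ) ^ 5 * (8 * free.U))
                free.B (B3free + 112 * c4) (64 * B3free + 89088 * c4)))
          + 36 * |(10 * wg * (c4 * cQ) ^ 2 + wgh * c4 ^ 2 / 2) / 3| with hA6
  set M₁ : ℝ := ∑ μ : Fin 4, ∑ ν : Fin 4, ∑ u ∈ box 4 3, |PiBF wg wgh V W v w μ ν u| with hM₁
  have hM₁0 : 0 ≤ M₁ := Finset.sum_nonneg fun _ _ => Finset.sum_nonneg fun _ _ => Finset.sum_nonneg fun _ _ => abs_nonneg _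
  have hA60 : 0 ≤ A6 := by
    set z₄ : Pt := fun _ => 4 with hz₄
    have hz : 4 ≤ supNorm z₄ := by
      have h := DyadicShell.natAbs_le_supNorm z₄ 0
      simp [hz₄] at h; omega
    have hfar := abs_PiBF_le_far (wg := wg) (wgh := wgh) (cQ := cQ) hδ hV hcovV h0V hgermV hW hv hcovv h0v hgermv hw 0 0 hz
    rw [← hA6] at hfar
    have hs : (0 : ℝ) < supNorm z₄ := by exact_mod_cast lt_of_lt_of_le (by norm_num) hz
    have h := (abs_nonneg _).trans hfar
    exact (div_nonneg_iff.mp h).elim (fun h => h.1) (fun h => absurd h.2 (not_le.mpr (pow_pos hs 6)))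
  refine ⟨64 * A6 + 4096 * M₁, by positivity, fun μ ν t => ?_⟩
  have hs0 : (0 : ℝ) ≤ supNorm t := Nat.cast_nonneg _
  have hs1 : (0 : ℝ) < (supNorm t : ℝ) + 1 := by linarith
  by_cases ht : 4 ≤ supNorm t
  · have hfar := abs_PiBF_le_far (wg := wg) (wgh := wgh) (cQ := cQ) hδ hV hcovV h0V hgermV hW hv hcovv h0v hgermv hw μ ν ht
    rw [← hA6] at hfar
    have hs : (0 : ℝ) < supNorm t := by exact_mod_cast lt_of_lt_of_le (by norm_num) ht
    refine hfar.trans ?_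
    rw [div_le_div_iff₀ (pow_pos hs 6) (pow_pos hs1 6)]
    have h64 : ((supNorm t : ℝ) + 1) ^ 6 ≤ 64 * (supNorm t : ℝ) ^ 6 := by
      have h1 : (supNorm t : ℝ) + 1 ≤ 2 * supNorm t := by
        have : (1 : ℝ) ≤ supNorm t := by exact_mod_cast le_trans (by norm_num) ht
        linarith
      calc ((supNorm t : ℝ) + 1) ^ 6 ≤ (2 * (supNorm t : ℝ)) ^ 6 := pow_le_pow_left₀ hs1.le h1 6
        _ = 64 * (supNorm t : ℝ) ^ 6 := by ring
    calc A6 * ((supNorm t : ℝ) + 1) ^ 6 ≤ A6 * (64 * (supNorm t : ℝ) ^ 6) := mul_le_mul_of_nonneg_left h64 hA60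
      _ = 64 * A6 * (supNorm t : ℝ) ^ 6 := by ring
      _ ≤ (64 * A6 + 4096 * M₁) * (supNorm t : ℝ) ^ 6 := by nlinarith [pow_pos hs 6]
  · have ht3 : supNorm t ≤ 3 := by omega
    have hub : t ∈ box 4 3 := mem_box_iff.mpr ht3
    have h1 : |PiBF wg wgh V W v w μ ν t| ≤ M₁ := by
      have a : |PiBF wg wgh V W v w μ ν t| ≤ ∑ u ∈ box 4 3, |PiBF wg wgh V W v w μ ν u| :=
        Finset.single_le_sum (f := fun u => |PiBF wg wgh V W v w μ ν u|) (fun u _ => abs_nonneg _) hub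
      have b : ∑ u ∈ box 4 3, |PiBF wg wgh V W v w μ ν u| ≤ ∑ ν' : Fin 4, ∑ u ∈ box 4 3, |PiBF wg wgh V W v w μ ν' u| :=
        Finset.single_le_sum (f := fun ν' => ∑ u ∈ box 4 3, |PiBF wg wgh V W v w μ ν' u|)
          (fun _ _ => Finset.sum_nonneg fun _ _ => abs_nonneg _) (Finset.mem_univ ν)
      have c : ∑ ν' : Fin 4, ∑ u ∈ box 4 3, |PiBF wg wgh V W v w μ ν' u| ≤ M₁ :=
        Finset.single_le_sum (f := fun μ' => ∑ ν' : Fin 4, ∑ u ∈ box 4 3, |PiBF wg wgh V W v w μ' ν' u|)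
          (fun _ _ => Finset.sum_nonneg fun _ _ => Finset.sum_nonneg fun _ _ => abs_nonneg _) (Finset.mem_univ μ)
      exact a.trans (b.trans c)
    have h4096 : ((supNorm t : ℝ) + 1) ^ 6 ≤ 4096 := by
      have : (supNorm t : ℝ) + 1 ≤ 4 := by
        have : (supNorm t : ℝ) ≤ 3 := by exact_mod_cast ht3
        linarith
      calc ((supNorm t : ℝ) + 1) ^ 6 ≤ (4 : ℝ) ^ 6 := pow_le_pow_left₀ hs1.le this 6
        _ = 4096 := by norm_num
    rw [le_div_iff₀ (pow_pos hs1 6)]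
    calc |PiBF wg wgh V W v w μ ν t| * ((supNorm t : ℝ) + 1) ^ 6 ≤ M₁ * 4096 :=
          mul_le_mul h1 h4096 (pow_nonneg hs1.le 6) hM₁0
      _ ≤ 64 * A6 + 4096 * M₁ := by nlinarith

end Sextic

end Summit.QuantumFields.BalabanUV.Beta.FP.PerfectPolarizationDecay

end
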